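import Mathlib.Algebra.BigOperators.Fin
import Mathlib.Data.Finset.Powerset
import Mathlib.Data.Nat.Choose.Bounds
import Literature.Computability.MetaComplexity.NWGenerator
import HarnessLib

/-!
# NW designs with linear intersections in a linear universe: the greedy code (Arora–Barak 2009, Lemma 20.14)

Second instalment of the design layer of `NWGenerator.lean` (which has the POLYNOMIAL designs of
Nisan–Wigderson / CIKK: blocks of size `n` in a universe of size `≤ 4n²`, i.e. seed length
`O(n²)`). The derandomization `BPP = P` from a `2^{Ω(n)}`-hard function (Impagliazzo–Wigderson
1997, Thm. 2; Arora–Barak 2009, Thm. 20.7 (1), the named fact `impagliazzo_wigderson` of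
`Complexity/CircuitLowerBounds.lean`) needs the OTHER regime of Nisan–Wigderson's Lemma 2.5 /
Arora–Barak's Lemma 20.14: seed length `O(n)`, intersections a constant FRACTION of `n`, and
`2^{Ω(n)}` blocks — obtained there by a greedy algorithm whose success is a probabilistic
(Chernoff) count. This file constructs that design, PROVED, in a form a machine can recompute:

* `graphBlock g` — the block `{(k, g k)}` of a word `g : [n] → [b]` in the universe `[n] × [b]`
  (so `|block| = n` automatically and `|block g ∩ block g'| = agree g g'`, the number of
  agreeing coordinates: `card_graphBlock_inter`, `isNWDesign_graphBlock`);
* `card_filter_le_agree_le` — the volume bound `#{c | agree c g ≥ d} ≤ 2ⁿ b^{n-d}` (a union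
  bound over the `d`-sets of agreeing coordinates, in place of the Chernoff estimate);
* `lexicode d cands` — the single greedy pass keeping every candidate that agrees with all kept
  words in `≤ d` places (`lexStep`), with its invariants `pairwise_lexFrom` (kept words are
  pairwise compatible) and `covered_lexFrom` (every candidate is kept or conflicts with a kept
  word), whence the Gilbert–Varshamov-type length bound `pow_le_length_lexicode_mul`:
  `bⁿ ≤ |lexicode| · 2ⁿ b^{n-(d+1)}` when the candidates exhaust `[b]ⁿ`;
* `cands n b` (the canonical enumeration of `[b]ⁿ` by base-`b` digits, `finFunctionFinEquiv`),
  `lexWords n b d`, `le_length_lexWords`, and the packaged design `lexDesign n b d N h` of `N`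
  blocks with `isNWDesign_lexDesign`, `exists_isNWDesign_graph`.

With `b = 4^r` and `d + 1 ≥ n/r` the condition `N 2ⁿ b^{n-(d+1)} ≤ bⁿ` holds for every `N ≤ 2ⁿ`:
`N` blocks of size `n`, seed length `ℓ = 4^r n`, intersections `≤ n/r`.

## References

* S. Arora, B. Barak, *Computational Complexity: A Modern Approach*, CUP 2009, Def. 20.13 and
  Lemma 20.14 with its proof (p. 413: greedy construction; (20.12)–(20.13)) [AroraBarakCC2009]
  (held text checked, PDF pp. 481, 483–484).
* N. Nisan, A. Wigderson, *Hardness vs randomness*, JCSS 49 (1994) 149–167, §2, Lemma 2.5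
  (designs with `l = O(n)` for `m = 2^{Ω(n)}` sets, greedy) [NisanWigderson1994].

## Design notes

* Words instead of sets: the universe is `[n] × [b]` and blocks are graphs, so the block size is
  fixed by construction and only agreements have to be controlled; the greedy pass is a left fold
  with a decidable test, so that the string machine of the NW generator (`Complexity/…`) can be
  proved to recompute `lexWords` literally.
* The volume bound is the crude `C(n, d) ≤ 2ⁿ`; it costs a constant factor in `b` and avoids
  entropy/Chernoff estimates.
-/

namespace Literature.Computability.MetaComplexity

open Finset

/-! ### Blocks as graphs of functions -/

section Graph

variable {n b : ℕ}

/-- The **graph block** of `g : [n] → [b]`: `k ↦ (k, g k)`, an `n`-subset of the universe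
`[n] × [b]` (the design of a code word: Nisan–Wigderson 1994, Lemma 2.5, greedy designs; here
presented through functions so that blocks automatically have size `n`). [folklore] -/
def graphBlock (g : Fin n → Fin b) : Fin n ↪ Fin n × Fin b :=
  ⟨fun k => (k, g k), fun _ _ h => (Prod.ext_iff.1 h).1⟩

/-- Unfolding `graphBlock`. [folklore] -/
@[simp] theorem graphBlock_apply (g : Fin n → Fin b) (k : Fin n) : graphBlock g k = (k, g k) := rfl

/-- The **agreement** of two words: the number of coordinates where they coincide. [folklore] -/
def agree (g g' : Fin n → Fin b) : ℕ := #{k : Fin n | g k = g' k}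

/-- Agreement is symmetric. [folklore] -/
theorem agree_comm (g g' : Fin n → Fin b) : agree g g' = agree g' g := by
  unfold agree; congr 1; ext k; simp [eq_comm]

/-- A word agrees with itself everywhere. [folklore] -/
@[simp] theorem agree_self (g : Fin n → Fin b) : agree g g = n := by simp [agree]

/-- Agreement is at most the length. [folklore] -/
theorem agree_le (g g' : Fin n → Fin b) : agree g g' ≤ n := by
  unfold agree; exact (card_filter_le _ _).trans (by simp)

/-- Two graph blocks meet in exactly `agree g g'` points. [folklore] -/
theorem card_graphBlock_inter (g g' : Fin n → Fin b) :
    #(univ.map (graphBlock g) ∩ univ.map (graphBlock g')) = agree g g' := by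
  have h : univ.map (graphBlock g) ∩ univ.map (graphBlock g') =
      (univ.filter fun k : Fin n => g k = g' k).map (graphBlock g) := by
    ext ⟨k, c⟩
    simp only [mem_inter, mem_map, mem_univ, true_and, graphBlock_apply, Prod.mk.injEq, mem_filter]
    constructor
    · rintro ⟨⟨k₁, rfl, rfl⟩, ⟨k₂, h₂, h₂'⟩⟩
      subst h₂
      exact ⟨k₂, h₂'.symm, rfl, rfl⟩
    · rintro ⟨k₁, hk, rfl, rfl⟩
      exact ⟨⟨k₁, rfl, rfl⟩, ⟨k₁, rfl, hk.symm⟩⟩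
  rw [h, card_map, agree]

/-- **Graphs of words with pairwise agreement `≤ d` form an NW design** with intersection
parameter `d`. [cite: NisanWigderson1994, Lemma 2.5] -/
theorem isNWDesign_graphBlock {ι : Type*} {d : ℕ} {G : ι → (Fin n → Fin b)}
    (h : ∀ ⦃i j : ι⦄, i ≠ j → agree (G i) (G j) ≤ d) : IsNWDesign d (fun i => graphBlock (G i)) := by
  intro i j hij
  rw [card_graphBlock_inter]
  exact h hij

/-! ### The volume bound: few words agree with a fixed word in many places -/

/-- **Volume of the agreement ball** (the union bound replacing the Chernoff estimate of
Arora–Barak 2009, proof of Lemma 20.14): the words agreeing with `g` in at least `d` places are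
covered by the `≤ 2ⁿ` events "agrees with `g` on `T`", `|T| = d`, each of `b^{n-d}` words; so
there are at most `2ⁿ b^{n-d}` of them. [cite: AroraBarakCC2009, Lemma 20.14 (proof)] -/
theorem card_filter_le_agree_le (g : Fin n → Fin b) (d : ℕ) :
    #{c : Fin n → Fin b | d ≤ agree c g} ≤ 2 ^ n * b ^ (n - d) := by
  classical
  -- cover by the events `E_T = {c | ∀ k ∈ T, c k = g k}`, `T` ranging over `d`-subsets
  have hcover : (univ.filter fun c : Fin n → Fin b => d ≤ agree c g) ⊆
      (univ.powersetCard d).biUnion fun T => univ.filter fun c : Fin n → Fin b => ∀ k ∈ T, c k = g k := by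
    intro c hc
    rw [mem_filter] at hc
    obtain ⟨T, hT, hTd⟩ := exists_subset_card_eq hc.2
    rw [mem_biUnion]
    refine ⟨T, mem_powersetCard.2 ⟨subset_univ _, hTd⟩, mem_filter.2 ⟨mem_univ _, fun k hk => ?_⟩⟩
    exact (mem_filter.1 (hT hk)).2
  -- each event has at most `b^{n-d}` members: restriction to `Tᶜ` is injective on it
  have hevent : ∀ T ∈ univ.powersetCard d,
      #(univ.filter fun c : Fin n → Fin b => ∀ k ∈ T, c k = g k) ≤ b ^ (n - d) := by
    intro T hT
    rw [mem_powersetCard] at hT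
    have hinj : Set.InjOn (fun (c : Fin n → Fin b) (k : {k // k ∈ Tᶜ}) => c k)
        (univ.filter fun c : Fin n → Fin b => ∀ k ∈ T, c k = g k) := by
      intro c hc c' hc' hcc'
      rw [coe_filter] at hc hc'
      funext k
      by_cases hk : k ∈ T
      · rw [hc.2 k hk, hc'.2 k hk]
      · exact congrFun hcc' ⟨k, mem_compl.2 hk⟩
    have h := card_le_card_of_injOn _ (fun c _ => mem_univ _) hinj
    refine h.trans ?_
    rw [card_univ, Fintype.card_fun, Fintype.card_fin, Fintype.card_coe, card_compl, hT.2,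
      Fintype.card_fin]
  calc #{c : Fin n → Fin b | d ≤ agree c g}
      ≤ #((univ.powersetCard d).biUnion fun T =>
          univ.filter fun c : Fin n → Fin b => ∀ k ∈ T, c k = g k) := card_le_card hcover
    _ ≤ ∑ T ∈ univ.powersetCard d, #(univ.filter fun c : Fin n → Fin b => ∀ k ∈ T, c k = g k) :=
        card_biUnion_le
    _ ≤ ∑ _T ∈ univ.powersetCard d, b ^ (n - d) := sum_le_sum hevent
    _ = #(univ.powersetCard d) * b ^ (n - d) := by rw [sum_const, smul_eq_mul]
    _ ≤ 2 ^ n * b ^ (n - d) := by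
        refine Nat.mul_le_mul_right _ ?_
        rw [card_powersetCard, card_univ, Fintype.card_fin]
        exact Nat.choose_le_two_pow n d

end Graph

/-! ### The greedy code (lexicode) -/

section Lexicode

variable {n b : ℕ}

/-- One step of the greedy pass: append the candidate if it agrees with every word kept so far
in at most `d` places. [cite: AroraBarakCC2009, Lemma 20.14 (proof: "add to `𝓘` the first
`n`-sized set `I` satisfying (*)")] -/
def lexStep (d : ℕ) (acc : List (Fin n → Fin b)) (c : Fin n → Fin b) : List (Fin n → Fin b) :=
  if ∀ g ∈ acc, agree c g ≤ d then acc ++ [c] else acc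

/-- **The greedy code** of a list of candidates: the single left-to-right pass keeping every
candidate compatible with all kept ones (the lexicographic code of coding theory; the greedy
design algorithm of Nisan–Wigderson 1994, Lemma 2.5 / Arora–Barak 2009, Lemma 20.14, run over
graphs of words). [cite: AroraBarakCC2009, Lemma 20.14] -/
def lexicode (d : ℕ) (cands : List (Fin n → Fin b)) : List (Fin n → Fin b) :=
  cands.foldl (lexStep d) []

/-- The greedy pass from an arbitrary accumulator (for the invariants). [folklore] -/
def lexFrom (d : ℕ) (acc : List (Fin n → Fin b)) (cands : List (Fin n → Fin b)) :
    List (Fin n → Fin b) :=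
  cands.foldl (lexStep d) acc

/-- `lexicode = lexFrom []`. [folklore] -/
theorem lexicode_eq_lexFrom (d : ℕ) (cands : List (Fin n → Fin b)) :
    lexicode d cands = lexFrom d [] cands := rfl

/-- The pass only appends: the accumulator is a prefix of the result. [folklore] -/
theorem prefix_lexFrom (d : ℕ) : ∀ (acc cands : List (Fin n → Fin b)), acc <+: lexFrom d acc cands
  | acc, [] => List.prefix_refl acc
  | acc, c :: cands => by
    rw [lexFrom, List.foldl_cons]
    refine List.IsPrefix.trans ?_ (prefix_lexFrom d (lexStep d acc c) cands)
    unfold lexStep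
    split_ifs
    · exact List.prefix_append acc [c]
    · exact List.prefix_refl acc

/-- Kept words are candidates or initial. [folklore] -/
theorem mem_lexFrom : ∀ {acc cands : List (Fin n → Fin b)} {g : Fin n → Fin b} (d : ℕ),
    g ∈ lexFrom d acc cands → g ∈ acc ∨ g ∈ cands
  | acc, [], g, d, h => Or.inl h
  | acc, c :: cands, g, d, h => by
    rw [lexFrom, List.foldl_cons] at h
    rcases mem_lexFrom d h with h1 | h1
    · unfold lexStep at h1
      split_ifs at h1
      · rw [List.mem_append, List.mem_singleton] at h1
        rcases h1 with h1 | rfl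
        · exact Or.inl h1
        · exact Or.inr List.mem_cons_self
      · exact Or.inl h1
    · exact Or.inr (List.mem_cons_of_mem c h1)

/-- **Pairwise compatibility**: if the accumulator is pairwise `d`-compatible, so is the result.
[cite: AroraBarakCC2009, Lemma 20.14] -/
theorem pairwise_lexFrom (d : ℕ) : ∀ {acc : List (Fin n → Fin b)} (cands : List (Fin n → Fin b)),
    acc.Pairwise (fun g g' => agree g g' ≤ d) →
      (lexFrom d acc cands).Pairwise (fun g g' => agree g g' ≤ d)
  | acc, [], h => h
  | acc, c :: cands, h => by
    rw [lexFrom, List.foldl_cons]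
    refine pairwise_lexFrom d cands ?_
    unfold lexStep
    split_ifs with hc
    · rw [List.pairwise_append]
      refine ⟨h, List.pairwise_singleton _ _, fun g hg c' hc' => ?_⟩
      rw [List.mem_singleton] at hc'
      subst hc'
      rw [agree_comm]
      exact hc g hg
    · exact h

/-- **Covering**: every candidate is kept or conflicts (agreement `> d`) with a kept word.
[cite: AroraBarakCC2009, Lemma 20.14] -/
theorem covered_lexFrom (d : ℕ) : ∀ (acc cands : List (Fin n → Fin b)) {c : Fin n → Fin b},
    c ∈ cands → c ∈ lexFrom d acc cands ∨ ∃ g ∈ lexFrom d acc cands, d < agree c g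
  | acc, [], c, h => absurd h List.not_mem_nil
  | acc, c' :: cands, c, h => by
    rw [lexFrom, List.foldl_cons]
    rcases List.mem_cons.1 h with rfl | h
    · -- the head: kept now (and forever, the pass only appends) or blocked by a kept word
      have hpre := prefix_lexFrom d (lexStep d acc c) cands
      unfold lexStep at hpre ⊢
      split_ifs at hpre ⊢ with hc
      · exact Or.inl (hpre.subset (List.mem_append_right acc List.mem_cons_self))
      · push Not at hc
        obtain ⟨g, hg, hgt⟩ := hc
        exact Or.inr ⟨g, hpre.subset hg, hgt⟩
    · exact covered_lexFrom d _ cands h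

/-- **The greedy code is long** (the counting half of Arora–Barak 2009, Lemma 20.14, with the
union bound of `card_filter_le_agree_le` for the Chernoff bound): if the candidates exhaust
`[b]ⁿ` and `d < n`, the conflict balls of the kept words cover `[b]ⁿ`, so
`bⁿ ≤ |lexicode| · 2ⁿ b^{n-(d+1)}`. [cite: AroraBarakCC2009, Lemma 20.14 (proof)] -/
theorem pow_le_length_lexicode_mul {d : ℕ} (hd : d < n) {cands : List (Fin n → Fin b)}
    (hall : ∀ c, c ∈ cands) :
    b ^ n ≤ (lexicode d cands).length * (2 ^ n * b ^ (n - (d + 1))) := by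
  classical
  set lex := lexicode d cands with hlex
  have hcov : (univ : Finset (Fin n → Fin b)) ⊆
      lex.toFinset.biUnion fun g => univ.filter fun c : Fin n → Fin b => d + 1 ≤ agree c g := by
    intro c _
    rw [mem_biUnion]
    rcases covered_lexFrom d [] cands (hall c) with h | ⟨g, hg, hgt⟩
    · exact ⟨c, List.mem_toFinset.2 h, mem_filter.2 ⟨mem_univ _, by rw [agree_self]; omega⟩⟩
    · exact ⟨g, List.mem_toFinset.2 hg, mem_filter.2 ⟨mem_univ _, hgt⟩⟩
  calc b ^ n = #(univ : Finset (Fin n → Fin b)) := by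
        rw [card_univ, Fintype.card_fun, Fintype.card_fin, Fintype.card_fin]
    _ ≤ #(lex.toFinset.biUnion fun g => univ.filter fun c : Fin n → Fin b => d + 1 ≤ agree c g) :=
        card_le_card hcov
    _ ≤ ∑ g ∈ lex.toFinset, #(univ.filter fun c : Fin n → Fin b => d + 1 ≤ agree c g) := card_biUnion_le
    _ ≤ ∑ _g ∈ lex.toFinset, 2 ^ n * b ^ (n - (d + 1)) := sum_le_sum fun g _ => card_filter_le_agree_le g _
    _ = #lex.toFinset * (2 ^ n * b ^ (n - (d + 1))) := by rw [sum_const, smul_eq_mul]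
    _ ≤ lex.length * (2 ^ n * b ^ (n - (d + 1))) := Nat.mul_le_mul_right _ (List.toFinset_card_le lex)

/-! ### The canonical candidates and the design -/

/-- **The canonical enumeration of `[b]ⁿ`** by `i < bⁿ`: the base-`b` digits of `i`
(`finFunctionFinEquiv`: digit `k` of `i` is `i / bᵏ mod b`). [folklore] -/
def cands (n b : ℕ) : List (Fin n → Fin b) := List.ofFn fun i : Fin (b ^ n) => finFunctionFinEquiv.symm i

/-- Every word is a canonical candidate. [folklore] -/
theorem mem_cands (c : Fin n → Fin b) : c ∈ cands n b := by
  rw [cands, List.mem_ofFn]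
  exact ⟨finFunctionFinEquiv c, Equiv.symm_apply_apply _ _⟩

/-- **The greedy design words**: the greedy code of the canonical enumeration.
[cite: AroraBarakCC2009, Lemma 20.14] -/
def lexWords (n b d : ℕ) : List (Fin n → Fin b) := lexicode d (cands n b)

/-- The greedy design words are pairwise `d`-compatible. [cite: AroraBarakCC2009, Lemma 20.14] -/
theorem pairwise_lexWords (n b d : ℕ) : (lexWords n b d).Pairwise (fun g g' => agree g g' ≤ d) :=
  pairwise_lexFrom d _ List.Pairwise.nil

/-- **Enough greedy design words**: if `N · 2ⁿ · b^{n-(d+1)} ≤ bⁿ` and `d < n` then the greedy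
code has at least `N` words. [cite: AroraBarakCC2009, Lemma 20.14] -/
theorem le_length_lexWords {N d : ℕ} (hb : 0 < b) (hd : d < n)
    (hN : N * (2 ^ n * b ^ (n - (d + 1))) ≤ b ^ n) : N ≤ (lexWords n b d).length := by
  have h := hN.trans (pow_le_length_lexicode_mul hd (mem_cands (b := b)))
  have hpos : 0 < 2 ^ n * b ^ (n - (d + 1)) := by positivity
  exact Nat.le_of_mul_le_mul_right h hpos

/-- **The greedy design words as a family**: the first `N` words of the greedy code.
[cite: AroraBarakCC2009, Lemma 20.14] -/
def lexDesignWords (n b d N : ℕ) (h : N ≤ (lexWords n b d).length) : Fin N → (Fin n → Fin b) :=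
  fun i => (lexWords n b d).get (Fin.castLE h i)

/-- Distinct greedy design words agree in at most `d` places. [cite: AroraBarakCC2009, Lemma 20.14] -/
theorem agree_lexDesignWords_le {n b d N : ℕ} (h : N ≤ (lexWords n b d).length) {i j : Fin N}
    (hij : i ≠ j) : agree (lexDesignWords n b d N h i) (lexDesignWords n b d N h j) ≤ d := by
  have hp := List.pairwise_iff_get.1 (pairwise_lexWords n b d)
  rcases lt_or_gt_of_ne (Fin.val_ne_of_ne hij) with hlt | hlt
  · exact hp _ _ (show Fin.castLE h i < Fin.castLE h j from hlt)
  · rw [agree_comm]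
    exact hp _ _ (show Fin.castLE h j < Fin.castLE h i from hlt)

/-- **The greedy NW design** (Nisan–Wigderson 1994, Lemma 2.5; Arora–Barak 2009, Lemma 20.14, over
graphs of words): `N` blocks of size `n` in the universe `[n] × [b]` with pairwise intersections
`≤ d`, available whenever `N · 2ⁿ · b^{n-(d+1)} ≤ bⁿ` (`le_length_lexWords`).
[cite: AroraBarakCC2009, Lemma 20.14] -/
def lexDesign (n b d N : ℕ) (h : N ≤ (lexWords n b d).length) : Fin N → (Fin n ↪ Fin n × Fin b) :=
  fun i => graphBlock (lexDesignWords n b d N h i)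

/-- The greedy design is an NW design with intersection parameter `d`.
[cite: AroraBarakCC2009, Lemma 20.14] -/
theorem isNWDesign_lexDesign {n b d N : ℕ} (h : N ≤ (lexWords n b d).length) :
    IsNWDesign d (lexDesign n b d N h) :=
  isNWDesign_graphBlock fun _ _ hij => agree_lexDesignWords_le h hij

/-- **Existence form**: for `0 < b`, `d < n` and `N · 2ⁿ · b^{n-(d+1)} ≤ bⁿ` there is an NW design
of `N` blocks of size `n` in the universe `[n] × [b]` (seed length `n b`) with intersections
`≤ d`. For `b = 2^{2r}`, `d + 1 ≥ n / r` this holds for all `N ≤ 2ⁿ` — linear seed, linear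
intersections, exponentially many blocks (the regime of `BPP = P`).
[cite: AroraBarakCC2009, Lemma 20.14] -/
theorem exists_isNWDesign_graph {n b d N : ℕ} (hb : 0 < b) (hd : d < n)
    (hN : N * (2 ^ n * b ^ (n - (d + 1))) ≤ b ^ n) :
    ∃ e : Fin N → (Fin n ↪ Fin n × Fin b), IsNWDesign d e :=
  ⟨lexDesign n b d N (le_length_lexWords hb hd hN), isNWDesign_lexDesign _⟩

end Lexicode

end Literature.Computability.MetaComplexity
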